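import Literature.NumberTheory.Transcendental.PrasadRapinchukLengths
import HarnessLib

/-!
# Prasad–Rapinchuk, Proposition 7.1: the transcendence count for a field of definition of
# transcendence degree `d`

Sequel of `Literature/NumberTheory/Transcendental/PrasadRapinchukLengths.lean` (the dictionary of
Prasad–Rapinchuk, Geom. Dedicata **172** (2014) = arXiv:1110.0141, §7, and the Schanuel step) and
`PrasadRapinchukLemma72.lean` (Lemma 7.2). There the arithmetic case `d = 0` of the transcendence
core of Proposition 7.1 is proved from `AlgIndepLogarithms`; here we prove the general case, from
Schanuel's conjecture, following the printed proof word for word: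

* `exists_algebraicIndependent_aeval_fibre_of_schanuel` — assume SC (`∀ n, SchanuelRank n`); let
  `𝒦 ⊂ ℂ` have `tr.deg_ℚ 𝒦 ≤ d`, let `a : ι → ℂ` (blocks `A_{γⱼ}` = fibres of `c : ι → κ`) and
  `b : ι' → ℂ` have exponentials algebraic over `𝒦` with `a ⊕ b` `ℚ`-linearly independent, and let
  `fⱼ = pⱼ(a|_{c⁻¹{j}})` for non-constant rational polynomials `pⱼ`. Then there is a set `J` of
  blocks with `#κ ≤ #J + d` such that `(fⱼ)_{j ∈ J}` is algebraically independent over `ℚ(B)`; in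
  particular `tr.deg_{ℚ(B)} ℚ(B)(f₁, …, f_m) ≥ m - d` — display (E:TD-1) of the paper, whence
  Prop. 7.1 (`tr.deg_{ℱ₂} ℱ₂(λ_{Γ₁}(γ₁), …, λ_{Γ₁}(γ_m)) ≥ m - d`) by the reductions recorded in the
  dictionary.

Printed proof (arXiv text p. 24) and its Lean counterpart: "by Schanuel's conjecture … the
transcendence degree of the field generated by `A ∪ B` is `≥ α + β - d`"
(`le_trdeg_adjoin_add_of_schanuel_of_isAlgebraic`), "so `tr.deg_{ℚ(B)} ℚ(A ∪ B) ≥ α - d`" (tower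
law `trdeg_add_eq` and `tr.deg ℚ(B) ≤ β`), "there exists a subset `C ⊂ A` of cardinality `≤ d`
such that the elements of `A ∖ C` are algebraically independent over `ℚ(B)`"
(`exists_isTranscendenceBasis_subset` inside the generating set `A`), "since `C` intersects at
most `d` of the sets `A_{γⱼ}` … the elements of `D = ⋃_{j ≤ m-d} A_{γⱼ}` are algebraically
independent over `ℚ(B)`" (an injection from the bad blocks into `C`), and "(E:TD-1) follows from"
Lemma 7.2 (`algebraicIndependent_of_mem_adjoin_fibre`, with
`aeval_not_mem_bot_of_algebraicIndependent` for `fⱼ ∉ ℚ(B)`). No definitions, no named facts.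
-/

noncomputable section

open Complex IntermediateField Set
open Literature.Barriers.Schanuel (AlgIndepLogarithms)

namespace Literature.NumberTheory.Transcendental

namespace PrasadRapinchuk

/-! ### General `d`: `m - d` of the blocks survive -/

/-- **Transcendence core of Prasad–Rapinchuk's Proposition 7.1, general `d`.** Assume Schanuel's
conjecture. Let `𝒦 ⊂ ℂ` have `tr.deg_ℚ 𝒦 ≤ d`; let `a : ι → ℂ`, `b : ι' → ℂ` have exponentials
algebraic over `𝒦` with `a ⊕ b` `ℚ`-linearly independent; let the blocks be the fibres of
`c : ι → κ` and `fⱼ = pⱼ(a|_{c⁻¹{j}})` with `pⱼ` non-constant rational polynomials. Then at least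
`#κ - d` of the `fⱼ` are algebraically independent over `ℚ(B)` — hence
`tr.deg_{ℚ(B)} ℚ(B)(f) ≥ m - d`, display (E:TD-1). Proof as printed: the Schanuel step gives
`tr.deg_{ℚ(B)} ℚ(A ∪ B) ≥ |A| - d`; a transcendence basis of `ℚ(B)(A)/ℚ(B)` inside `A` misses a
set `C` of at most `d` indices, which meets at most `d` blocks; Lemma 7.2 on the other blocks.
[cite: PrasadRapinchuk2013, Prop. 7.1 (proof)] -/
theorem exists_algebraicIndependent_aeval_fibre_of_schanuel (hSC : ∀ n, SchanuelRank n)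
    (K : IntermediateField ℚ ℂ) {d : ℕ} (hK : Algebra.trdeg ℚ K ≤ d)
    {ι ι' κ : Type*} [Fintype ι] [Fintype ι'] [Fintype κ] (c : ι → κ) {a : ι → ℂ} {b : ι' → ℂ}
    (ha : ∀ i, IsAlgebraic K (cexp (a i))) (hb : ∀ i, IsAlgebraic K (cexp (b i)))
    (hli : LinearIndependent ℚ (Sum.elim a b))
    (p : (j : κ) → MvPolynomial (c ⁻¹' ({j} : Set κ)) ℚ)
    (hp : ∀ j (r : ℚ), p j ≠ MvPolynomial.C r) :
    ∃ J : Finset κ, Fintype.card κ ≤ J.card + d ∧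
      AlgebraicIndependent (adjoin ℚ (Set.range b))
        (fun j : J => MvPolynomial.aeval (fun i : (c ⁻¹' ({(j : κ)} : Set κ)) => a i) (p j)) := by
  classical
  set F : IntermediateField ℚ ℂ := adjoin ℚ (Set.range b) with hF
  -- Step 1: the Schanuel step, `#ι + #ι' ≤ tr.deg ℚ(A ∪ B) + d`
  obtain ⟨N, ⟨e⟩⟩ := Finite.exists_equiv_fin (ι ⊕ ι')
  have hli' : LinearIndependent ℚ (Sum.elim a b ∘ e.symm) := hli.comp _ e.symm.injective
  have halg' : ∀ k, IsAlgebraic K (cexp ((Sum.elim a b ∘ e.symm) k)) := by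
    intro k
    show IsAlgebraic K (cexp (Sum.elim a b (e.symm k)))
    cases e.symm k with
    | inl i => exact ha i
    | inr i => exact hb i
  have hstep := le_trdeg_adjoin_add_of_schanuel_of_isAlgebraic hSC K hK _ hli' halg'
  have hrange : Set.range (Sum.elim a b ∘ e.symm) = Set.range b ∪ Set.range a := by
    rw [e.symm.surjective.range_comp, Set.Sum.elim_range, Set.union_comm]
  rw [hrange] at hstep
  have hN : N = Fintype.card ι + Fintype.card ι' := by
    have := Fintype.card_congr e
    simp only [Fintype.card_sum, Fintype.card_fin] at this
    omega
  -- Step 2: tower `tr.deg ℚ(B ∪ A) = tr.deg ℚ(B) + tr.deg_{ℚ(B)} ℚ(B)(A)` and `tr.deg ℚ(B) ≤ #ι'`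
  have e1 := (equivOfEq (adjoin_adjoin_left ℚ (Set.range b) (Set.range a))).trdeg_eq
  have htower : Algebra.trdeg ℚ (adjoin ℚ (Set.range b ∪ Set.range a)) =
      Algebra.trdeg ℚ F + Algebra.trdeg F (adjoin F (Set.range a)) :=
    calc Algebra.trdeg ℚ (adjoin ℚ (Set.range b ∪ Set.range a))
        = Algebra.trdeg ℚ ((adjoin F (Set.range a)).restrictScalars ℚ) := e1.symm
      _ = Algebra.trdeg ℚ (adjoin F (Set.range a)) := rfl
      _ = Algebra.trdeg ℚ F + Algebra.trdeg F (adjoin F (Set.range a)) :=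
          (trdeg_add_eq ℚ F (A := adjoin F (Set.range a))).symm
  have hFle : Algebra.trdeg ℚ F ≤ Fintype.card ι' := by
    refine (trdeg_adjoin_le_mk (F := ℚ) (Set.range b)).trans ?_
    rw [Cardinal.mk_fintype]
    exact_mod_cast Fintype.card_range_le b
  -- Step 3: a transcendence basis of `F(A)/F` inside `A`
  set A' := adjoin F (Set.range a) with hA'
  haveI : Algebra.IsAlgebraic (Algebra.adjoin F (((↑) : A' → ℂ) ⁻¹' Set.range a)) A' :=
    isAlgebraic_adjoin_over_algebraAdjoin _
  obtain ⟨tS, htS, hbasis⟩ :=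
    exists_isTranscendenceBasis_subset (R := F) (A := A') (((↑) : A' → ℂ) ⁻¹' Set.range a)
  have hcardt : Cardinal.mk tS = Algebra.trdeg F A' := hbasis.cardinalMk_eq_trdeg
  have htSfin : tS.Finite :=
    ((Set.finite_range a).preimage Subtype.val_injective.injOn).subset htS
  haveI : Fintype tS := htSfin.fintype
  -- the indices of the basis elements
  have hex : ∀ x : tS, ∃ i, a i = (x : A') := fun x => htS x.2
  choose φ hφ using hex
  have hφinj : Function.Injective φ := by
    intro x y hxy
    apply Subtype.ext; apply Subtype.ext
    rw [← hφ x, ← hφ y, hxy]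
  set S : Finset ι := Finset.univ.image φ with hS
  have hScard : S.card = Fintype.card tS := by
    rw [hS, Finset.card_image_of_injective _ hφinj, Finset.card_univ]
  have hmemS : ∀ {i}, i ∈ S → ∃ x : tS, φ x = i := fun hi => by
    simpa [hS] using hi
  -- `a` is algebraically independent over `F` on `S`
  have hindepS : AlgebraicIndependent F (fun i : S => a i) := by
    have hval : AlgebraicIndependent F (fun x : tS => ((x : A') : ℂ)) :=
      hbasis.1.map' (f := A'.val) Subtype.val_injective
    choose ψ hψ using fun i : S => hmemS i.2
    have hψinj : Function.Injective ψ := by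
      intro i i' h
      apply Subtype.ext
      rw [← hψ i, ← hψ i', h]
    have := hval.comp ψ hψinj
    convert this using 1
    funext i
    show a i = ((ψ i : tS) : A')
    rw [← hφ (ψ i), hψ i]
  -- Step 4: counting, `#ι ≤ #S + d`
  have hcount : Fintype.card ι ≤ S.card + d := by
    have htfin : Cardinal.mk tS = (Fintype.card tS : Cardinal) := Cardinal.mk_fintype _
    have h1 : ((Fintype.card ι + Fintype.card ι' : ℕ) : Cardinal) ≤
        (Fintype.card ι' : Cardinal) + (Fintype.card tS : Cardinal) + d := by
      calc ((Fintype.card ι + Fintype.card ι' : ℕ) : Cardinal) = (N : Cardinal) := by rw [hN]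
        _ ≤ Algebra.trdeg ℚ (adjoin ℚ (Set.range b ∪ Set.range a)) + d := hstep
        _ = Algebra.trdeg ℚ F + Algebra.trdeg F A' + d := by rw [htower]
        _ ≤ (Fintype.card ι' : Cardinal) + (Fintype.card tS : Cardinal) + d := by
            rw [← htfin, hcardt]
            exact add_le_add (add_le_add hFle le_rfl) le_rfl
    rw [hScard]
    have h3 : Fintype.card ι + Fintype.card ι' ≤ Fintype.card ι' + Fintype.card tS + d := by
      exact_mod_cast h1
    omega
  -- the good blocks: entirely inside `S`
  set J : Finset κ := Finset.univ.filter (fun j => ∀ i, c i = j → i ∈ S) with hJ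
  have hJcard : Fintype.card κ ≤ J.card + d := by
    -- bad blocks inject into `ι ∖ S`
    have hbad : ∀ j ∈ Jᶜ, ∃ i, c i = j ∧ i ∉ S := by
      intro j hj
      simp only [hJ, Finset.mem_compl, Finset.mem_filter, Finset.mem_univ, true_and,
        not_forall] at hj
      obtain ⟨i, hi, hiS⟩ := hj
      exact ⟨i, hi, hiS⟩
    choose g hg using hbad
    have hle : (Jᶜ).card ≤ (Sᶜ).card := by
      have := Fintype.card_le_of_injective
        (fun j : (Jᶜ : Finset κ) =>
          (⟨g j j.2, Finset.mem_compl.2 (hg j j.2).2⟩ : (Sᶜ : Finset ι)))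
        (by
          intro j j' h
          have h' : g j j.2 = g j' j'.2 := congrArg Subtype.val h
          apply Subtype.ext
          rw [← (hg j j.2).1, ← (hg j' j'.2).1, h'])
      simpa only [Fintype.card_coe] using this
    rw [Finset.card_compl, Finset.card_compl] at hle
    have := J.card_le_univ
    have := S.card_le_univ
    omega
  refine ⟨J, hJcard, ?_⟩
  -- Step 5: Lemma 7.2 for the sub-family of good blocks
  have hJS : ∀ i, c i ∈ J → i ∈ S := by
    intro i hi
    simp only [hJ, Finset.mem_filter, Finset.mem_univ, true_and] at hi
    exact hi i rfl
  let ι₀ := {i : ι // c i ∈ J}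
  let c₀ : ι₀ → J := fun i => ⟨c i, i.2⟩
  have ht₀ : AlgebraicIndependent F (fun i : ι₀ => a i) := by
    have := hindepS.comp (fun i : ι₀ => (⟨i, hJS i i.2⟩ : S))
      (fun i i' h => Subtype.ext (by simpa using congrArg Subtype.val h))
    exact this
  refine algebraicIndependent_of_mem_adjoin_fibre F c₀ ht₀ _ (fun j => ?_) (fun j hj => ?_)
  · have hle : Algebra.adjoin ℚ (Set.range fun i : (c ⁻¹' ({(j : κ)} : Set κ)) => a i) ≤
        ((adjoin F ((fun i : ι₀ => a i) '' (c₀ ⁻¹' {j}))).restrictScalars ℚ).toSubalgebra := by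
      rw [Algebra.adjoin_le_iff]
      rintro _ ⟨i, rfl⟩
      have hi : c i = j := i.2
      refine subset_adjoin F _ ⟨⟨i, by rw [hi]; exact j.2⟩, ?_, rfl⟩
      show c₀ ⟨i, _⟩ ∈ ({j} : Set J)
      exact Subtype.ext hi
    have hmem : MvPolynomial.aeval (fun i : (c ⁻¹' ({(j : κ)} : Set κ)) => a i) (p j) ∈
        Algebra.adjoin ℚ (Set.range fun i : (c ⁻¹' ({(j : κ)} : Set κ)) => a i) := by
      rw [Algebra.adjoin_range_eq_range_aeval]
      exact ⟨p j, rfl⟩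
    exact hle hmem
  · have hblock : AlgebraicIndependent F (fun i : (c ⁻¹' ({(j : κ)} : Set κ)) => a i) := by
      have := hindepS.comp (fun i : (c ⁻¹' ({(j : κ)} : Set κ)) => (⟨i, hJS i (by
          have hi : c i = j := i.2
          rw [hi]; exact j.2)⟩ : S))
        (fun i i' h => Subtype.ext (by simpa using congrArg Subtype.val h))
      exact this
    exact aeval_not_mem_bot_of_algebraicIndependent F hblock (p j) (hp j) hj

end PrasadRapinchuk

end Literature.NumberTheory.Transcendental
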